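import Mathlib
import Literature.AlgebraicGeometry.Resolution.PthRootGeneratorsValuation

/-!
# The digit ring `k[T]/(T^{p^L} − a)` of a field of characteristic `p` (chain W4.1, crux `Steer`)

OURS (campaign res-hironaka, rung L, slot W4.1; helper for crux `Steer` stmt-ResolutionOfSingularities-16345,
K-side support of the K(3) line — card `frobenius-closing-imperfect` §9 "THE DIGIT RING" of seat
res-L0-w41-idea-1). Pure field theory in characteristic `p`; NOT a statement of any manuscript; nothing
here is attributed to [claim: Hironaka2017, status: under-review]. AI-written; weaker than expert review.

`k` a field of characteristic `p`, `a ∈ k`, `L ∈ ℕ`. The **digit evaluation** `Θ̃ : k[T] → k`,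
`Σ_j x_j T^j ↦ Σ_j x_j^{p^L} a^j`, is `Polynomial.eval₂RingHom (iterateFrobenius k p L) a`; it kills
`T^{p^L} − a` and factors through the **digit ring** `AdjoinRoot (X ^ p ^ L - C a)`. Everything is
def-free (ring maps out of the digit ring are pinned by their values on `AdjoinRoot.root` / `AdjoinRoot.of`).
* §1 `derivation_eval₂_iterateFrobenius` (`δ (Θ̃ g) = Θ̃ (g') · δ a`), the clean test
  `exists_pow_eq_eval₂_iterateFrobenius_iff`, the digit shift `eval₂_iterateFrobenius_(succ_)expand`.
* §2 `irreducible_X_pow_char_pow_sub_C`: `X ^ p ^ L - C a` is IRREDUCIBLE once `a ∉ k^p` (every prime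
  `p`, `p = 2` included — Mathlib's `X_pow_sub_C_irreducible_of_prime_pow` is the Kummer version, `p ≠ 2`);
  so ring maps out of the digit ring are injective (`ringHom_injective_of_not_pow`).
* §3 (`p`-rank one, `[k : k^p] = p`, `a ∉ k^p`): `eval₂_iterateFrobenius_surjective` (`k = k^{p^L}[a]`),
  `ringHom_bijective_of_pRankOne` / `lift_iterateFrobenius_bijective` (`k[T]/(T^{p^L} − a) ≅ k`).
* §4 `exists_derivation_adjoinRoot`: `d/dT` descends to the digit ring (`1 ≤ L`).
* §5 the swap `T ↦ T'^p − X_j` over the digit ring of `σ`: `swap_modulus` (`T^{p^L} − σ^p ↦ −X_j^{p^L}`),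
  `swap_congr` (agreement with any Taylor map `φ`, `φ (σ^p) = σ^p − X_j`, modulo `𝔪_X ^ p ^ L`).

[cite: Matsumura1987, §26 p. 202] (`p`-bases); the `k^p`-basis `1, a, …, a^{p-1}` is the tree's
`Literature.AlgebraicGeometry.Resolution.exists_eq_sum_smul_pow_and_pow_eq`.
-/

noncomputable section

-- `Summit.<S>.<S>.…` duplicates the summit name by design (single-problem summit).
set_option linter.dupNamespace false

open Polynomial

namespace Summit.ResolutionOfSingularities.ResolutionOfSingularities.Theorems.SwitchingDichotomy.DigitRing

universe u

/-! ## §1 The digit evaluation `Θ̃ = eval₂RingHom (iterateFrobenius k p L) a` -/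

section DigitEval

variable {k : Type u} [Field k] (p : ℕ) [Fact p.Prime] [CharP k p] (L : ℕ) (a : k)

/-- `Θ̃ (C x) = x ^ p ^ L`. [folklore] -/
theorem eval₂_iterateFrobenius_C (x : k) :
    eval₂RingHom (iterateFrobenius k p L) a (C x) = x ^ p ^ L := by
  simp [iterateFrobenius_def]

/-- `Θ̃ X = a`. [folklore] -/
theorem eval₂_iterateFrobenius_X : eval₂RingHom (iterateFrobenius k p L) a X = a := by
  simp

omit [Fact p.Prime] in
/-- In characteristic `p`, `(p ^ L : k) = 0` for `1 ≤ L`. [folklore] -/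
theorem cast_pow_eq_zero (hL : 0 < L) : ((p ^ L : ℕ) : k) = 0 := by
  obtain ⟨L', rfl⟩ : ∃ L', L = L' + 1 := ⟨L - 1, by omega⟩
  rw [pow_succ, Nat.cast_mul, CharP.cast_eq_zero k p, mul_zero]

/-- **`Θ̃` intertwines `d/dT` with every derivation** (`1 ≤ L`): `δ (Θ̃ g) = Θ̃ (g') · δ a` — the
digits `x_j ^ p ^ L` are inert (res-L0-w41-idea-1's `derivation_digitEvalPoly`, same proof). [folklore] -/
theorem derivation_eval₂_iterateFrobenius (hL : 0 < L) (δ : Derivation ℤ k k) (g : k[X]) :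
    δ (eval₂RingHom (iterateFrobenius k p L) a g) =
      eval₂RingHom (iterateFrobenius k p L) a (derivative g) * δ a := by
  induction g using Polynomial.induction_on' with
  | add f g hf hg =>
      rw [map_add, map_add, derivative_add, map_add, hf, hg, add_mul]
  | monomial m x =>
      have hx : δ (x ^ p ^ L) = 0 := by
        rw [δ.leibniz_pow, nsmul_eq_mul, cast_pow_eq_zero p L hL, zero_mul]
      simp only [coe_eval₂RingHom, eval₂_monomial, derivative_monomial, iterateFrobenius_def,
        map_mul, map_natCast]
      rw [δ.leibniz, δ.leibniz_pow, hx, smul_zero, add_zero]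
      simp only [nsmul_eq_mul, smul_eq_mul]
      ring

/-- **The clean test in digits**: for a derivation `D` with kernel exactly `k^p` and `D a = 1`,
`Θ̃ g ∈ k^p ↔ Θ̃ (g') = 0` (`1 ≤ L`; res-L0-w41-idea-1's `exists_pow_eq_digitEvalPoly_iff`). [folklore] -/
theorem exists_pow_eq_eval₂_iterateFrobenius_iff (hL : 0 < L) (D : Derivation ℤ k k)
    (hker : ∀ z : k, D z = 0 ↔ ∃ y : k, y ^ p = z) (hDa : D a = 1) (g : k[X]) :
    (∃ y : k, y ^ p = eval₂RingHom (iterateFrobenius k p L) a g) ↔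
      eval₂RingHom (iterateFrobenius k p L) a (derivative g) = 0 := by
  rw [← hker, derivation_eval₂_iterateFrobenius p L a hL D g, hDa, mul_one]

/-- **The swap on digits is `T ↦ T'^p`**: `Θ̃_{L,σ} (g (T ^ p)) = Θ̃_{L,σ^p} (g)`
(res-L0-w41-idea-1's `digitEvalPoly_expand`). [folklore] -/
theorem eval₂_iterateFrobenius_expand (σ : k) (g : k[X]) :
    eval₂RingHom (iterateFrobenius k p L) σ (expand k p g) =
      eval₂RingHom (iterateFrobenius k p L) (σ ^ p) g := by
  simp only [coe_eval₂RingHom, eval₂_eq_eval_map, map_expand, expand_eval]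

/-- **The digit shift**: `Θ̃_{L+1,a} (g (T ^ p)) = (Θ̃_{L,a} g) ^ p`. [folklore] -/
theorem eval₂_iterateFrobenius_succ_expand (g : k[X]) :
    eval₂RingHom (iterateFrobenius k p (L + 1)) a (expand k p g) =
      (eval₂RingHom (iterateFrobenius k p L) a g) ^ p := by
  have key : (eval₂RingHom (iterateFrobenius k p (L + 1)) a).comp
      (expand k p : k[X] →ₐ[k] k[X]).toRingHom =
      (frobenius k p).comp (eval₂RingHom (iterateFrobenius k p L) a) := by
    refine Polynomial.ringHom_ext (fun x => ?_) ?_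
    · simp only [RingHom.coe_comp, Function.comp_apply, AlgHom.toRingHom_eq_coe, RingHom.coe_coe,
        expand_C, coe_eval₂RingHom, eval₂_C, iterateFrobenius_def, frobenius_def, pow_succ,
        pow_mul]
    · simp only [RingHom.coe_comp, Function.comp_apply, AlgHom.toRingHom_eq_coe, RingHom.coe_coe,
        expand_X, coe_eval₂RingHom, eval₂_X_pow, eval₂_X, frobenius_def]
  simpa [frobenius_def] using congrArg (fun φ : k[X] →+* k => φ g) key

end DigitEval

/-! ## §2 `X ^ p ^ L - C a` is irreducible in characteristic `p` when `a ∉ k^p` -/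

section Irreducible

variable (p : ℕ) [Fact p.Prime]

/-- In a simple radical extension `k⟮x⟯`, `x ^ p = a ∈ k`, every `p`-th power lies in `k`
(Frobenius is additive and `(Σ c_i x^i)^p = Σ c_i^p a^i`). [folklore] -/
theorem pow_mem_range_of_mem_adjoin {k E : Type*} [Field k] [Field E] [Algebra k E] [CharP E p]
    {x : E} {a : k} (hx : x ^ p = algebraMap k E a) {y : E}
    (hy : y ∈ IntermediateField.adjoin k {x}) : y ^ p ∈ (algebraMap k E).range := by
  induction hy using IntermediateField.adjoin_induction with
  | mem z hz =>
      rw [Set.mem_singleton_iff] at hz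
      subst hz
      exact ⟨a, hx.symm⟩
  | algebraMap c => exact ⟨c ^ p, by rw [map_pow]⟩
  | add z w _ _ hz hw =>
      obtain ⟨⟨c, hc⟩, ⟨d, hd⟩⟩ := And.intro hz hw
      exact ⟨c + d, by rw [map_add, hc, hd, add_pow_char]⟩
  | inv z _ hz =>
      obtain ⟨c, hc⟩ := hz
      exact ⟨c⁻¹, by rw [map_inv₀, hc, inv_pow]⟩
  | mul z w _ _ hz hw =>
      obtain ⟨⟨c, hc⟩, ⟨d, hd⟩⟩ := And.intro hz hw
      exact ⟨c * d, by rw [map_mul, hc, hd, mul_pow]⟩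

/-- **Irreducibility of `X ^ p ^ L - C a` in characteristic `p`** for `a ∈ k` NOT a `p`-th power
(every `L`, every prime `p`, `p = 2` included). Induction on `L` through Mathlib's
`X_pow_mul_sub_C_irreducible`: over `k⟮x⟯`, `x ^ p = a`, the new radicand `x` is again not a `p`-th
power, since `k⟮x⟯^p ⊆ k` while `x ∉ k`. [cite: Matsumura1987, §26 p. 202] -/
theorem irreducible_X_pow_char_pow_sub_C :
    ∀ (L : ℕ) {k : Type u} [Field k] [CharP k p] {a : k},
      (∀ b : k, b ^ p ≠ a) → Irreducible (X ^ p ^ L - C a : k[X]) := by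
  have hp : p.Prime := Fact.out
  intro L
  induction L with
  | zero =>
      intro k _ _ a _
      simpa using irreducible_X_sub_C a
  | succ L ih =>
      intro k _ _ a ha
      rw [pow_succ]
      refine X_pow_mul_sub_C_irreducible (X_pow_sub_C_irreducible_of_prime hp ha) ?_
      intro E _ _ x hx
      haveI : CharP E p := charP_of_injective_algebraMap (algebraMap k E).injective p
      haveI : CharP (IntermediateField.adjoin k {x}) p :=
        charP_of_injective_algebraMap (algebraMap k (IntermediateField.adjoin k {x})).injective p
      refine ih ?_
      intro b hb
      have hxp : x ^ p = algebraMap k E a := by -- `x ^ p = a`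
        have h := minpoly.aeval k x
        rwa [hx, map_sub, map_pow, aeval_X, aeval_C, sub_eq_zero] at h
      have hbE : ((b : E)) ^ p = x := by -- `b ^ p = x` inside `k⟮x⟯`, so `x = (b : E) ^ p ∈ k`
        simpa using congrArg (fun z : IntermediateField.adjoin k {x} => (z : E)) hb
      obtain ⟨c, hc⟩ := pow_mem_range_of_mem_adjoin p hxp b.2
      rw [hbE] at hc
      have hdeg := congrArg natDegree hx -- then `minpoly k x` has degree `1`, not `p`
      rw [← hc, minpoly.eq_X_sub_C, natDegree_X_sub_C, natDegree_X_pow_sub_C] at hdeg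
      exact hp.one_lt.ne hdeg

variable {k : Type u} [Field k] [CharP k p] (L : ℕ) {a : k}

/-- The digit ring is a field when `a ∉ k^p`: ring maps out of it are injective. [folklore] -/
theorem ringHom_injective_of_not_pow (ha : ∀ b : k, b ^ p ≠ a) {B : Type*} [Semiring B]
    [Nontrivial B] (Θ : AdjoinRoot (X ^ p ^ L - C a : k[X]) →+* B) : Function.Injective Θ := by
  haveI : Fact (Irreducible (X ^ p ^ L - C a : k[X])) :=
    ⟨irreducible_X_pow_char_pow_sub_C p L ha⟩
  exact RingHom.injective Θ

end Irreducible

/-! ## §3 `p`-rank one: `Θ` is bijective -/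

section PRankOne

variable {k : Type u} [Field k] (p : ℕ) [Fact p.Prime] [CharP k p]

/-- **`p`-rank-one digit decomposition**: if `[k : k^p] = p` and `a ∉ k^p`, every `z ∈ k` is
`Σ_{j<p} y_j ^ p · a ^ j`. [cite: Matsumura1987, §26 p. 202] -/
theorem exists_eq_sum_pow_mul_pow (hrank : Module.finrank (frobenius k p).fieldRange k = p)
    {a : k} (ha : ∀ b : k, b ^ p ≠ a) (z : k) :
    ∃ y : Fin p → k, z = ∑ j, y j ^ p * a ^ (j : ℕ) := by
  have hp : p.Prime := Fact.out
  set F : Subfield k := (frobenius k p).fieldRange with hF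
  haveI : CharP F p := (algebraMap F k).charP (algebraMap F k).injective p
  have hapF : a ^ p ∈ F := RingHom.mem_fieldRange.mpr ⟨a, frobenius_def ..⟩
  have hy : a ∉ Set.range (algebraMap F k) := by
    rintro ⟨c, hc⟩
    obtain ⟨y, hy⟩ := RingHom.mem_fieldRange.mp c.2
    exact ha y (by rw [← frobenius_def, hy]; exact hc)
  have hyp : a ^ p = algebraMap F k ⟨a ^ p, hapF⟩ := rfl
  obtain ⟨κ, hz, -⟩ :=
    Literature.AlgebraicGeometry.Resolution.exists_eq_sum_smul_pow_and_pow_eq (A := F) (K := F)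
      (L := k) hp hrank ⟨a ^ p, hapF⟩ a hy hyp z
  have hκ : ∀ j, ∃ y : k, y ^ p = (κ j : k) := fun j => by
    obtain ⟨y, hy⟩ := RingHom.mem_fieldRange.mp (κ j).2
    exact ⟨y, by rw [← frobenius_def]; exact hy⟩
  choose y hy using hκ
  exact ⟨y, hz.trans (Finset.sum_congr rfl fun j _ => by rw [Algebra.smul_def, hy]; rfl)⟩

/-- **`k = k^{p^L}[a]` in `p`-rank one**: `Θ̃_L` is SURJECTIVE for every `L` (induction:
`z = Σ_j y_j^p a^j`, `y_j = Θ̃_L g_j`, `Θ̃_{L+1} (Σ_j g_j(T^p) T^j) = z`). [cite: Matsumura1987, §26 p. 202] -/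
theorem eval₂_iterateFrobenius_surjective (hrank : Module.finrank (frobenius k p).fieldRange k = p)
    {a : k} (ha : ∀ b : k, b ^ p ≠ a) :
    ∀ L : ℕ, Function.Surjective (eval₂RingHom (iterateFrobenius k p L) a) := by
  intro L
  induction L with
  | zero =>
      intro z
      exact ⟨C z, by simp⟩
  | succ L ih =>
      intro z
      obtain ⟨y, hz⟩ := exists_eq_sum_pow_mul_pow p hrank ha z
      choose g hg using fun j => ih (y j)
      refine ⟨∑ j, expand k p (g j) * X ^ (j : ℕ), ?_⟩
      rw [map_sum, hz]
      refine Finset.sum_congr rfl fun j _ => ?_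
      rw [map_mul, map_pow, eval₂_iterateFrobenius_succ_expand, hg, eval₂_iterateFrobenius_X]

/-- **The digit evaluation is bijective in `p`-rank one** (`[k : k^p] = p`, `a ∉ k^p`): every ring
map `Θ : AdjoinRoot (X ^ p ^ L - C a) → k` with `Θ root = a`, `Θ (of x) = x ^ p ^ L` is a bijection
(closes res-L0-w41-idea-1's `digitEval_bijective_of_pBasis`). [cite: Matsumura1987, §26 p. 202] -/
theorem ringHom_bijective_of_pRankOne (hrank : Module.finrank (frobenius k p).fieldRange k = p)
    (L : ℕ) {a : k} (ha : ∀ b : k, b ^ p ≠ a)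
    (Θ : AdjoinRoot (X ^ p ^ L - C a : k[X]) →+* k) (hroot : Θ (AdjoinRoot.root _) = a)
    (hof : ∀ x : k, Θ (AdjoinRoot.of _ x) = x ^ p ^ L) : Function.Bijective Θ := by
  refine ⟨ringHom_injective_of_not_pow p L ha Θ, fun z => ?_⟩
  have key : Θ.comp (AdjoinRoot.mk (X ^ p ^ L - C a : k[X])) =
      eval₂RingHom (iterateFrobenius k p L) a := by
    refine Polynomial.ringHom_ext (fun x => ?_) ?_
    · rw [RingHom.comp_apply, AdjoinRoot.mk_C, hof, eval₂_iterateFrobenius_C]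
    · rw [RingHom.comp_apply, AdjoinRoot.mk_X, hroot, eval₂_iterateFrobenius_X]
  obtain ⟨g, hg⟩ := eval₂_iterateFrobenius_surjective p hrank ha L z
  exact ⟨AdjoinRoot.mk _ g, by rw [← RingHom.comp_apply, key, hg]⟩

/-- Literal form for `AdjoinRoot.lift` (res-L0-w41-idea-1's `digitEval`). [folklore] -/
theorem lift_iterateFrobenius_bijective (hrank : Module.finrank (frobenius k p).fieldRange k = p)
    (L : ℕ) {a : k} (ha : ∀ b : k, b ^ p ≠ a)
    (h : eval₂ (iterateFrobenius k p L) a (X ^ p ^ L - C a) = 0) :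
    Function.Bijective (AdjoinRoot.lift (iterateFrobenius k p L) a h) :=
  ringHom_bijective_of_pRankOne p hrank L ha _ (AdjoinRoot.lift_root h)
    (fun x => by rw [AdjoinRoot.lift_of h, iterateFrobenius_def])

end PRankOne

/-! ## §4 `d/dT` on the digit ring -/

section DigitDerivation

variable {k : Type u} [Field k] (p : ℕ) [Fact p.Prime] [CharP k p] (L : ℕ) (a : k)

omit [Fact p.Prime] in
/-- In characteristic `p` the modulus `X ^ p ^ L - C a` has derivative `0` (`1 ≤ L`). [folklore] -/
theorem derivative_modulus (hL : 0 < L) : derivative (X ^ p ^ L - C a : k[X]) = 0 := by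
  rw [derivative_sub, derivative_C, sub_zero, derivative_X_pow, cast_pow_eq_zero p L hL, C_0,
    zero_mul]

/-- **`d/dT` descends to the digit ring** (`1 ≤ L`; the modulus has derivative `0`): a derivation
`d` with `d (mk g) = mk (g')`, so `d root = 1`, `d (of x) = 0` (the binder `_hd` of res-L0-w41-idea-1's
`NoFormalDigitCycle`). [folklore] -/
theorem exists_derivation_adjoinRoot (hL : 0 < L) :
    ∃ d : Derivation ℤ (AdjoinRoot (X ^ p ^ L - C a : k[X])) (AdjoinRoot (X ^ p ^ L - C a : k[X])),
      (∀ g : k[X], d (AdjoinRoot.mk _ g) = AdjoinRoot.mk _ (derivative g)) ∧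
      d (AdjoinRoot.root _) = 1 ∧ ∀ x : k, d (AdjoinRoot.of _ x) = 0 := by
  set f : k[X] := X ^ p ^ L - C a with hf
  have hmonic : f.Monic := monic_X_pow_sub_C a (pow_ne_zero L (Fact.out : p.Prime).ne_zero)
  -- the `k`-linear map `mk ∘ d/dT ∘ (canonical representative)`
  let D : AdjoinRoot f →ₗ[k] AdjoinRoot f :=
    (Ideal.Quotient.mkₐ k (Ideal.span {f})).toLinearMap ∘ₗ
      (derivative : k[X] →ₗ[k] k[X]) ∘ₗ AdjoinRoot.modByMonicHom hmonic
  have hD : ∀ g : k[X], D (AdjoinRoot.mk f g) = AdjoinRoot.mk f (derivative g) := by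
    intro g
    show Ideal.Quotient.mkₐ k (Ideal.span {f}) (derivative (AdjoinRoot.modByMonicHom hmonic
      (AdjoinRoot.mk f g))) = _
    rw [AdjoinRoot.modByMonicHom_mk, modByMonic_eq_sub_mul_div g f, derivative_sub,
      derivative_mul, derivative_modulus p L a hL, zero_mul, zero_add, Ideal.Quotient.mkₐ_eq_mk]
    show AdjoinRoot.mk f _ = _
    rw [map_sub, map_mul, AdjoinRoot.mk_self, zero_mul, sub_zero]
  have hleib : ∀ u v : AdjoinRoot f, D (u * v) = u • D v + v • D u := by
    intro u v
    induction u using AdjoinRoot.induction_on with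
    | ih g =>
    induction v using AdjoinRoot.induction_on with
    | ih h =>
    rw [← map_mul, hD, hD, hD, derivative_mul, smul_eq_mul, smul_eq_mul, map_add, map_mul, map_mul]
    ring
  refine ⟨(Derivation.mk' D hleib).restrictScalars ℤ, fun g => hD g, ?_, fun x => ?_⟩
  · show D (AdjoinRoot.root f) = 1
    rw [← AdjoinRoot.mk_X, hD, derivative_X, map_one]
  · show D (AdjoinRoot.of f x) = 0
    rw [← AdjoinRoot.mk_C, hD, derivative_C, map_zero]

end DigitDerivation

/-! ## §5 The swap `T ↦ T'^p − X_j` into power series over the digit ring of `σ` -/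

section DigitSwap

variable {k : Type u} [Field k] (p : ℕ) [Fact p.Prime] [CharP k p] (L : ℕ) (σ : k)
  {n : ℕ} (j : Fin n)

omit [CharP k p] in
/-- The digit ring is nontrivial (the modulus has positive degree). [folklore] -/
theorem nontrivial_adjoinRoot : Nontrivial (AdjoinRoot (X ^ p ^ L - C σ : k[X])) :=
  AdjoinRoot.nontrivial _ (by
    rw [degree_X_pow_sub_C (pow_pos (Fact.out : p.Prime).pos L)]
    exact_mod_cast (pow_ne_zero L (Fact.out : p.Prime).ne_zero))

/-- The digit ring has characteristic `p`. [folklore] -/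
theorem charP_adjoinRoot : CharP (AdjoinRoot (X ^ p ^ L - C σ : k[X])) p := by
  haveI := nontrivial_adjoinRoot p L σ
  exact charP_of_injective_ringHom (AdjoinRoot.of (X ^ p ^ L - C σ : k[X])).injective p

omit [Fact p.Prime] [CharP k p] in
/-- Power series over a ring of characteristic `p` have characteristic `p`. [folklore] -/
theorem charP_mvPowerSeries {R : Type*} [CommRing R] [CharP R p] {ι : Type*} :
    CharP (MvPowerSeries ι R) p :=
  charP_of_injective_ringHom (MvPowerSeries.C_injective (σ := ι) (R := R)) p

omit [Fact p.Prime] [CharP k p] in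
/-- In the digit ring of `σ`, `root ^ p ^ L = σ`. [folklore] -/
theorem root_pow_eq :
    AdjoinRoot.root (X ^ p ^ L - C σ : k[X]) ^ p ^ L = AdjoinRoot.of _ σ := by
  have h := AdjoinRoot.mk_self (f := (X ^ p ^ L - C σ : k[X]))
  rw [map_sub, map_pow, AdjoinRoot.mk_X, AdjoinRoot.mk_C, sub_eq_zero] at h
  exact h

/-- **The old modulus goes to `−X_j ^ p ^ L`** under the swap `T ↦ root^p − X_j`, `x ↦ x` into
`B⟦X⟧`, `B` the digit ring of `σ`: `S (T^{p^L} − σ^p) = (root^p − X_j)^{p^L} − σ^p = −X_j^{p^L}` — the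
swap acts on `d`-jets exactly for `d < p^L` (closes res-L0-w41-idea-1's `swapDigitHom_modulus`). [folklore] -/
theorem swap_modulus
    (S : k[X] →+* MvPowerSeries (Fin n) (AdjoinRoot (X ^ p ^ L - C σ : k[X])))
    (hSC : ∀ x : k, S (C x) = MvPowerSeries.C (AdjoinRoot.of _ x))
    (hSX : S X = MvPowerSeries.C (AdjoinRoot.root _ ^ p) - MvPowerSeries.X j) :
    S (X ^ p ^ L - C (σ ^ p)) = -(MvPowerSeries.X j) ^ p ^ L := by
  haveI := charP_adjoinRoot p L σ
  haveI : CharP (MvPowerSeries (Fin n) (AdjoinRoot (X ^ p ^ L - C σ : k[X]))) p :=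
    charP_mvPowerSeries p
  rw [map_sub, map_pow, hSX, hSC, sub_pow_char_pow, ← map_pow, ← pow_mul, mul_comm, pow_mul,
    root_pow_eq, ← map_pow]
  ring

/-- **Swap congruence** (closes res-L0-w41-idea-1's `swapDigitHom_congr`): `B` the digit ring of
`σ`, `Θ_σ : B → k` the digit evaluation (`root ↦ σ`, `x ↦ x^{p^L}`), `S : k[T] → B⟦X⟧` the swap and
`φ : k → k⟦X⟧` any ring map which is the identity on constant coefficients with `φ (σ^p) = σ^p − X_j`.
Then `φ (Θ̃_{σ^p} g) − map Θ_σ (S g) ∈ 𝔪_X ^ p ^ L`: the two ring maps `k[T] → k⟦X⟧ / 𝔪_X^{p^L}` agree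
on `T` and on constants (`φ x = x + m`, `m ∈ 𝔪_X`, so `φ (x^{p^L}) = x^{p^L} + m^{p^L}`). [folklore] -/
theorem swap_congr (φ : k →+* MvPowerSeries (Fin n) k)
    (hφ₀ : ∀ x : k, MvPowerSeries.constantCoeff (φ x) = x)
    (hφσ : φ (σ ^ p) = MvPowerSeries.C (σ ^ p) - MvPowerSeries.X j)
    (Θ : AdjoinRoot (X ^ p ^ L - C σ : k[X]) →+* k) (hroot : Θ (AdjoinRoot.root _) = σ)
    (hof : ∀ x : k, Θ (AdjoinRoot.of _ x) = x ^ p ^ L)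
    (S : k[X] →+* MvPowerSeries (Fin n) (AdjoinRoot (X ^ p ^ L - C σ : k[X])))
    (hSC : ∀ x : k, S (C x) = MvPowerSeries.C (AdjoinRoot.of _ x))
    (hSX : S X = MvPowerSeries.C (AdjoinRoot.root _ ^ p) - MvPowerSeries.X j) (g : k[X]) :
    φ (eval₂RingHom (iterateFrobenius k p L) (σ ^ p) g) - MvPowerSeries.map Θ (S g) ∈
      IsLocalRing.maximalIdeal (MvPowerSeries (Fin n) k) ^ p ^ L := by
  haveI : CharP (MvPowerSeries (Fin n) k) p := charP_mvPowerSeries p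
  set I : Ideal (MvPowerSeries (Fin n) k) := IsLocalRing.maximalIdeal (MvPowerSeries (Fin n) k) ^ p ^ L
  rw [← Ideal.Quotient.eq]
  -- two ring maps `k[T] → k⟦X⟧ / I`
  have key : (Ideal.Quotient.mk I).comp (φ.comp (eval₂RingHom (iterateFrobenius k p L) (σ ^ p))) =
      (Ideal.Quotient.mk I).comp ((MvPowerSeries.map Θ).comp S) := by
    refine Polynomial.ringHom_ext (fun x => ?_) ?_
    · show Ideal.Quotient.mk I (φ (eval₂RingHom (iterateFrobenius k p L) (σ ^ p) (C x))) =
        Ideal.Quotient.mk I (MvPowerSeries.map Θ (S (C x)))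
      rw [eval₂_iterateFrobenius_C, hSC, MvPowerSeries.map_C, hof, Ideal.Quotient.eq, map_pow,
        map_pow]
      -- `φ x = C x + m`, `m ∈ 𝔪_X`
      have hm : φ x - MvPowerSeries.C x ∈ IsLocalRing.maximalIdeal (MvPowerSeries (Fin n) k) := by
        rw [IsLocalRing.mem_maximalIdeal, mem_nonunits_iff, MvPowerSeries.isUnit_iff_constantCoeff,
          map_sub, hφ₀, MvPowerSeries.constantCoeff_C, sub_self]
        exact not_isUnit_zero
      obtain ⟨m, hmI, hx⟩ : ∃ m ∈ IsLocalRing.maximalIdeal (MvPowerSeries (Fin n) k),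
          φ x = MvPowerSeries.C x + m :=
        ⟨φ x - MvPowerSeries.C x, hm, by ring⟩
      rw [hx, add_pow_char_pow, add_sub_cancel_left]
      exact Ideal.pow_mem_pow hmI _
    · simp only [RingHom.coe_comp, Function.comp_apply, eval₂_iterateFrobenius_X, hφσ, hSX, map_sub,
        MvPowerSeries.map_C, MvPowerSeries.map_X, map_pow, hroot]
  simpa using congrArg (fun ψ : k[X] →+* MvPowerSeries (Fin n) k ⧸ I => ψ g) key

end DigitSwap

end Summit.ResolutionOfSingularities.ResolutionOfSingularities.Theorems.SwitchingDichotomy.DigitRing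

end
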